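import Mathlib
import Literature.NumberTheory.LFunctions.ZetaQuotientKernelTheorem
import Literature.NumberTheory.LFunctions.TuranOneSided
import Literature.NumberTheory.LFunctions.LiouvilleLinearRelations
import HarnessLib

/-!
# Haselgrove's theorem: the kernel theorems for Pólya's `L(x)` and Turán's `T(x)`

Topic `Literature/NumberTheory/LFunctions` (trunk T-ANT). The instances, for

* Pólya's sum `L(x) = Σ_{n≤x} λ(n)` (`liouvilleSum`, `A(u) = e^{-u/2}L(e^u)`, `LiouvilleOneSided.lean`),
* Turán's sum `T(x) = Σ_{n≤x} λ(n)/n` (`liouvilleHarmonicSum`, `B(u) = e^{u/2}T(e^u)`,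
  `TuranOneSided.lean`),

of the abstract kernel theorem `zetaQuot_frequently_gt_and_lt` (`ZetaQuotientKernelTheorem.lean`),
i.e. the inequalities (5) of Borwein–Ferguson–Mossinghoff, Math. Comp. 77 (2008), p. 1683,

  `liminf A ≤ A*(y) ≤ limsup A`,  `A*(y) = 1/ζ(½) + 2 Re Σ_{0<γ<T} k(γ) ζ(2ρ)/(ρζ'(ρ)) e^{iγy}`   (4)–(5)
  `liminf B ≤ B*(y) ≤ limsup B`,  `B*(y) = -1/ζ(½) + 2 Re Σ_{0<γ<T} k(γ) ζ(2ρ)/((ρ-1)ζ'(ρ)) e^{iγy}`   (7)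

(Ingham 1942; Haselgrove 1958), for an arbitrary admissible kernel with transform `k` supported
in `[-T, T]` under the hypothesis that the zeros below `T` are simple and on the line ("Naturally,
one obtains the same conclusion if the Riemann hypothesis is false, or if its zeros are not all
simple", BFM p. 1683 — that remark is the Landau step, proved in the `…OneSided` files):
`polya_kernelTheorem`, `turan_kernelTheorem` (with `polyaKernelSum = A*`, `turanKernelSum = B*` as
complex sums over `|γ| < T`, whose real parts are the printed `A*`, `B*`).

## The easy signs

The two Landau halves of Haselgrove's "both `L(x)` and `T(x)` change sign infinitely often" —
`L(n) < 0` and `T(n) > 0` infinitely often (bias terms `1/ζ(½) < 0`, `-1/ζ(½) > 0` of (4), (7)) —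
are the tree's `frequently_liouvilleSum_natCast_neg` (`LiouvilleOneSidedRH.lean`) and
`Literature.Barriers.RiemannHypothesis.frequently_liouvilleHarmonicSum_pos`
(`LiouvilleSignConjecturesHaselgrove.lean`); they are not repeated here (the kernel theorems at height
`14`, where the zero set is empty, would give them again).

## The hard signs: Haselgrove's route, from one good point

"if one can find values for `m` and `y` for which `A*_m(y) > 0`, then it follows that `L(n) > 0` for
infinitely many integers `n` … Haselgrove found that selecting `m = 1000` and `y = 831.847` produces
`A*_m(y) ≈ .00495` … `y = 853.853` or `y = 996.980` produces a negative value of `B*_m(y)`. It follows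
that `T(n) < 0` for infinitely many integers `n`" (BFM pp. 1683–1684). The implications are proved
here for the Jurkat–Peyerimhoff weight `k(t) = g(t/T₁)` at any height `T₁ ≤ T` (hypotheses: the
zeros below `T` are simple and on the line, and the sign of `Re A*`, resp. `Re B*`, at one point):
`frequently_liouvilleSum_natCast_pos_of_polyaKernelSum_pos` (**`L(n) > 0` infinitely often**),
`frequently_liouvilleHarmonicSum_natCast_neg_of_turanKernelSum_neg` (**`T(n) < 0` infinitely
often**), with the quantitative real forms `exists_pos_frequently_liouvilleSum_gt_…`,
`exists_neg_frequently_liouvilleHarmonicSum_lt_…`. No named fact is introduced: the numerical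
hypotheses (at `T = 2516`, `T₁ = 1000` — Haselgrove's `m = 1000`, 649 zeros — `y_L = 831.84844`,
`y_T = 996.98037`) are *proved* by the certified computation `LiouvilleCertificate.lean` and fed in by
`HaselgroveNumericsProofs.lean`.

## References

* [BorweinFergusonMossinghoff2008] P. Borwein, R. Ferguson, M. J. Mossinghoff, *Sign changes in
  sums of the Liouville function*, Math. Comp. 77 (2008), 1681–1694: §1, (3)–(7) pp. 1683–1684.
* [HaselgroveMathematika1958] C. B. Haselgrove, *A disproof of a conjecture of Pólya*,
  Mathematika 5 (1958), 141–145.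
* [Ingham1942] A. E. Ingham, *On two conjectures in the theory of numbers*, Amer. J. Math. 64
  (1942), 313–319.
* [OdlyzkoTeRiele1985] A. M. Odlyzko, H. J. J. te Riele, J. reine angew. Math. 357 (1985), §4.1
  (4.1) (the Jurkat–Peyerimhoff kernel).
-/

noncomputable section

open Complex Filter Asymptotics MeasureTheory Set
open scoped Real Topology ComplexConjugate

namespace Literature.NumberTheory.LFunctions

/-! ## `A*` and `B*` -/

/-- `A*(y)` of BFM (4) for a general weight `k` and height `T`, as a complex sum over all zeros
`ρ = ½+iγ`, `|γ| < T`: `1/ζ(½) + Σ k(γ) e^{iγy} ζ(2ρ)/(ρζ'(ρ))` (its real part is the printed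
`1/ζ(½) + 2 Re Σ_{0<γ<T} …` when `k` is real and even). [cite: BorweinFergusonMossinghoff2008, §1 (4) p. 1683] -/
def polyaKernelSum (k : ℝ → ℂ) (T y : ℝ) : ℂ :=
  1 / riemannZeta (1 / 2) +
    ∑ ρ ∈ (zetaZerosBelow_finite T).toFinset,
      k ρ.im * cexp (I * (ρ.im * y)) * (riemannZeta (2 * ρ) / (ρ * deriv riemannZeta ρ))

/-- `B*(y)` of BFM (7) for a general weight `k` and height `T`:
`-1/ζ(½) + Σ_{|γ|<T} k(γ) e^{iγy} ζ(2ρ)/((ρ-1)ζ'(ρ))`. [cite: BorweinFergusonMossinghoff2008, §1 (7) p. 1684] -/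
def turanKernelSum (k : ℝ → ℂ) (T y : ℝ) : ℂ :=
  -(1 / riemannZeta (1 / 2)) +
    ∑ ρ ∈ (zetaZerosBelow_finite T).toFinset,
      k ρ.im * cexp (I * (ρ.im * y)) * (riemannZeta (2 * ρ) / ((ρ - 1) * deriv riemannZeta ρ))

/-- `A*` is the sum of the abstract kernel theorem for `q(s) = 1/(½+s)`. [cite: BorweinFergusonMossinghoff2008, §1 (4) p. 1683] -/
theorem polyaKernelSum_eq (k : ℝ → ℂ) (T y : ℝ) :
    polyaKernelSum k T y = zetaQuotInghamSum (fun s : ℂ ↦ 1 / (1 / 2 + s)) k T y := by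
  unfold polyaKernelSum zetaQuotInghamSum
  have hζ := riemannZeta_one_half_ne_zero
  congr 1
  · field_simp; norm_num
  · refine Finset.sum_congr rfl fun ρ _ ↦ ?_
    dsimp only
    have : (1 / 2 : ℂ) + (ρ - 1 / 2) = ρ := by ring
    rw [this, mul_one_div, div_div]

/-- `B*` is the sum of the abstract kernel theorem for `q(s) = 1/(s-½)`. [cite: BorweinFergusonMossinghoff2008, §1 (7) p. 1684] -/
theorem turanKernelSum_eq (k : ℝ → ℂ) (T y : ℝ) :
    turanKernelSum k T y = zetaQuotInghamSum (fun s : ℂ ↦ 1 / (s - 1 / 2)) k T y := by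
  unfold turanKernelSum zetaQuotInghamSum
  have hζ := riemannZeta_one_half_ne_zero
  congr 1
  · field_simp; norm_num
  · refine Finset.sum_congr rfl fun ρ _ ↦ ?_
    dsimp only
    have : ρ - 1 / 2 - 1 / 2 = ρ - 1 := by ring
    rw [this, mul_one_div, div_div]

/-- `q(s) = 1/(s-½)` is holomorphic on the strip `-¼ < Re s < ½`. [folklore] -/
theorem differentiableOn_turanQ : DifferentiableOn ℂ (fun s : ℂ ↦ 1 / (s - 1 / 2)) qStrip := by
  intro s hs
  refine ((differentiableAt_const _).div (differentiableAt_id.sub (differentiableAt_const _))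
    ?_).differentiableWithinAt
  intro h; have := congrArg Complex.re h
  have h1 := hs.2
  simp at this; linarith

/-! ## The kernel theorems -/

/-- **The kernel theorem for Pólya's sum** (BFM (5), p. 1683: "for any fixed positive real
numbers `m` and `y`, Ingham proved that `liminf A ≤ … ≤ A*_m(y) ≤ … ≤ limsup A`", here for an
arbitrary admissible kernel in place of Fejér's): if `K` is admissible (`C²`, `≥ 0`, even,
`O((1+y²)⁻¹)`, transform `k` vanishing for `|t| ≥ T`, `k(0) = 1`) and the zeros `β+iγ` of `ζ` with
`0 < β < 1`, `|γ| < T` are simple and on the line, then for every `y₀`: `L(x) > a√x` for arbitrarily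
large `x` whenever `a < Re A*(y₀)`, and `L(x) < a√x` for arbitrarily large `x` whenever
`a > Re A*(y₀)`. [cite: BorweinFergusonMossinghoff2008, §1 (5) p. 1683; HaselgroveMathematika1958] -/
theorem polya_kernelTheorem (K : ℝ → ℝ) (T : ℝ) (hK2 : ContDiff ℝ 2 K) (hKnn : ∀ y : ℝ, 0 ≤ K y)
    (hKev : ∀ y : ℝ, K (-y) = K y) (hKO : K =O[atTop] fun y : ℝ ↦ (1 + y ^ 2)⁻¹)
    (hkz : ∀ t : ℝ, T ≤ |t| → kernelTransform K t = 0) (hk0 : kernelTransform K 0 = 1)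
    (hzeros : ∀ ρ : ℂ, riemannZeta ρ = 0 → 0 < ρ.re → ρ.re < 1 → |ρ.im| < T →
      ρ.re = 1 / 2 ∧ deriv riemannZeta ρ ≠ 0)
    (y₀ : ℝ) :
    (∀ a : ℝ, a < (polyaKernelSum (kernelTransform K) T y₀).re →
      ∃ᶠ x : ℝ in atTop, a * Real.sqrt x < liouvilleSum x) ∧
    (∀ a : ℝ, (polyaKernelSum (kernelTransform K) T y₀).re < a →
      ∃ᶠ x : ℝ in atTop, (liouvilleSum x : ℝ) < a * Real.sqrt x) := by
  have h := zetaQuot_frequently_gt_and_lt measurable_normalizedLiouville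
    (fun u hu ↦ normalizedLiouville_of_neg hu) normalizedLiouville_locally_bounded
    differentiableOn_one_div_half_add (fun a ha ↦ normalizedLiouville_laplace_zetaQuot ha)
    K T hK2 hKnn hKev hKO hkz hk0 hzeros y₀
  rw [← polyaKernelSum_eq] at h
  exact ⟨fun a ha ↦ frequently_liouville_gt_of_normalizedLiouville (h.1 a ha),
    fun a ha ↦ frequently_liouville_lt_of_normalizedLiouville (h.2 a ha)⟩

/-- **The kernel theorem for Turán's sum** (BFM p. 1684: "inequalities analogous to those in (5)
hold for the functions `B(x)` and `B*_m(x)`"): under the same hypotheses, for every `y₀`: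
`T(x)√x > a` for arbitrarily large `x` whenever `a < Re B*(y₀)`, and `T(x)√x < a` for arbitrarily
large `x` whenever `a > Re B*(y₀)`. [cite: BorweinFergusonMossinghoff2008, §1 (7) p. 1684; HaselgroveMathematika1958] -/
theorem turan_kernelTheorem (K : ℝ → ℝ) (T : ℝ) (hK2 : ContDiff ℝ 2 K) (hKnn : ∀ y : ℝ, 0 ≤ K y)
    (hKev : ∀ y : ℝ, K (-y) = K y) (hKO : K =O[atTop] fun y : ℝ ↦ (1 + y ^ 2)⁻¹)
    (hkz : ∀ t : ℝ, T ≤ |t| → kernelTransform K t = 0) (hk0 : kernelTransform K 0 = 1)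
    (hzeros : ∀ ρ : ℂ, riemannZeta ρ = 0 → 0 < ρ.re → ρ.re < 1 → |ρ.im| < T →
      ρ.re = 1 / 2 ∧ deriv riemannZeta ρ ≠ 0)
    (y₀ : ℝ) :
    (∀ a : ℝ, a < (turanKernelSum (kernelTransform K) T y₀).re →
      ∃ᶠ x : ℝ in atTop, a < liouvilleHarmonicSum x * Real.sqrt x) ∧
    (∀ a : ℝ, (turanKernelSum (kernelTransform K) T y₀).re < a →
      ∃ᶠ x : ℝ in atTop, liouvilleHarmonicSum x * Real.sqrt x < a) := by
  have h := zetaQuot_frequently_gt_and_lt measurable_normalizedTuran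
    (fun u hu ↦ normalizedTuran_of_neg hu) normalizedTuran_locally_bounded
    differentiableOn_turanQ (fun a ha ↦ normalizedTuran_laplace_of_oneSided ha)
    K T hK2 hKnn hKev hKO hkz hk0 hzeros y₀
  rw [← turanKernelSum_eq] at h
  exact ⟨fun a ha ↦ frequently_turan_gt_of_normalizedTuran (h.1 a ha),
    fun a ha ↦ frequently_turan_lt_of_normalizedTuran (h.2 a ha)⟩

/-! ## From real `x` to integers `n` -/

/-- From "frequently in real `x`" to "frequently in integers `n = ⌊x⌋`" for a property invariant
under `x ↦ ⌊x⌋` (a property of a step function such as `L` or `T`). [folklore] -/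
theorem frequently_natCast_of_frequently_step {p : ℝ → Prop} (hp : ∀ x : ℝ, p (⌊x⌋₊ : ℕ) ↔ p x)
    (h : ∃ᶠ x : ℝ in atTop, p x) : ∃ᶠ n : ℕ in atTop, p n := by
  rw [frequently_atTop] at h ⊢
  intro N
  obtain ⟨x, hx, hpx⟩ := h N
  exact ⟨⌊x⌋₊, Nat.le_floor hx, (hp x).2 hpx⟩

/-! ## The hard signs from one good point of `A*`, `B*` (Haselgrove's route) -/

/-- The Jurkat–Peyerimhoff kernel at height `T₁` in the kernel theorems. [cite: OdlyzkoTeRiele1985, §4.1 (4.1) p. 150] -/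
theorem exists_admissible_kernel_jurkatPeyerimhoff {T₁ : ℝ} (hT₁ : 0 < T₁) :
    ∃ K : ℝ → ℝ, ContDiff ℝ 2 K ∧ (∀ y : ℝ, 0 ≤ K y) ∧ (∀ y : ℝ, K (-y) = K y) ∧
      (K =O[atTop] fun y : ℝ ↦ (1 + y ^ 2)⁻¹) ∧
      (∀ t : ℝ, T₁ ≤ |t| → kernelTransform K t = 0) ∧ kernelTransform K 0 = 1 ∧
      kernelTransform K = fun t : ℝ ↦ (jurkatPeyerimhoffKernel (t / T₁) : ℂ) := by
  obtain ⟨K, hK₁, hK₂, hK₃, hK₄, hK₅⟩ := jurkatPeyerimhoffKernel_admissible_holds T₁ hT₁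
  refine ⟨K, hK₁, hK₂, hK₃, hK₄, fun t ht ↦ ?_, ?_, funext hK₅⟩
  · rw [hK₅, jurkatPeyerimhoffKernel_of_one_le_abs, Complex.ofReal_zero]
    rw [abs_div, abs_of_pos hT₁, le_div_iff₀ hT₁, one_mul]
    exact ht
  · rw [hK₅, zero_div, jurkatPeyerimhoffKernel_zero, Complex.ofReal_one]

/-- **"If one can find values for `m` and `y` for which `A*_m(y) > 0`, then it follows that
`L(n) > 0` for infinitely many integers `n`"** (BFM 2008 p. 1683; Haselgrove's route), real form,
for the Jurkat–Peyerimhoff weight `k(t) = g(t/T₁)` at a height `T₁ ≤ T` with the zeros below `T`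
simple and on the line: `Re A*(y) > 0` at one `y` gives `a > 0` with `L(x) > a√x` for arbitrarily
large `x`. [cite: BorweinFergusonMossinghoff2008, §1 (5) p. 1683] [cite: HaselgroveMathematika1958, main theorem] -/
theorem exists_pos_frequently_liouvilleSum_gt_of_polyaKernelSum_pos {T T₁ : ℝ} (hT₁ : 0 < T₁)
    (hT₁T : T₁ ≤ T)
    (hz : ∀ ρ : ℂ, riemannZeta ρ = 0 → 0 < ρ.re → ρ.re < 1 → |ρ.im| < T →
      ρ.re = 1 / 2 ∧ deriv riemannZeta ρ ≠ 0)
    {y : ℝ} (hy : 0 < (polyaKernelSum (fun t : ℝ ↦ (jurkatPeyerimhoffKernel (t / T₁) : ℂ)) T y).re) :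
    ∃ a : ℝ, 0 < a ∧ ∃ᶠ x : ℝ in atTop, a * Real.sqrt x < liouvilleSum x := by
  obtain ⟨K, hK₁, hK₂, hK₃, hK₄, hK₅, hK₆, hk⟩ := exists_admissible_kernel_jurkatPeyerimhoff hT₁
  set c : ℝ := (polyaKernelSum (fun t : ℝ ↦ (jurkatPeyerimhoffKernel (t / T₁) : ℂ)) T y).re with hc
  refine ⟨c / 2, by linarith, ?_⟩
  have := (polya_kernelTheorem K T hK₁ hK₂ hK₃ hK₄ (fun t ht ↦ hK₅ t (hT₁T.trans ht)) hK₆ hz y).1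
    (c / 2)
  rw [hk] at this
  exact this (by linarith)

/-- **`A*(y) > 0` at one point ⟹ `L(n) > 0` for infinitely many integers `n`** (BFM 2008 p. 1683,
the sentence quoted above; `L` is a step function). [cite: BorweinFergusonMossinghoff2008, §1 (5) p. 1683] [cite: HaselgroveMathematika1958, main theorem] -/
theorem frequently_liouvilleSum_natCast_pos_of_polyaKernelSum_pos {T T₁ : ℝ} (hT₁ : 0 < T₁)
    (hT₁T : T₁ ≤ T)
    (hz : ∀ ρ : ℂ, riemannZeta ρ = 0 → 0 < ρ.re → ρ.re < 1 → |ρ.im| < T →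
      ρ.re = 1 / 2 ∧ deriv riemannZeta ρ ≠ 0)
    {y : ℝ} (hy : 0 < (polyaKernelSum (fun t : ℝ ↦ (jurkatPeyerimhoffKernel (t / T₁) : ℂ)) T y).re) :
    ∃ᶠ n : ℕ in atTop, 0 < liouvilleSum n := by
  obtain ⟨a, ha, hfr⟩ := exists_pos_frequently_liouvilleSum_gt_of_polyaKernelSum_pos hT₁ hT₁T hz hy
  have h' : ∃ᶠ x : ℝ in atTop, 0 < liouvilleSum x := by
    refine (hfr.and_eventually (eventually_ge_atTop 0)).mono fun x ⟨hx, hx0⟩ ↦ ?_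
    have : 0 ≤ a * Real.sqrt x := mul_nonneg ha.le (Real.sqrt_nonneg x)
    exact_mod_cast this.trans_lt hx
  exact frequently_natCast_of_frequently_step (p := fun x ↦ 0 < liouvilleSum x)
    (fun x ↦ by simp [liouvilleSum, Nat.floor_natCast]) h'

/-- **A negative value of `B*_m(y)` ⟹ `T(x)√x < a` for some `a < 0` and arbitrarily large `x`**
(BFM 2008 p. 1684: "produces a negative value of `B*_m(y)`. It follows that `T(n) < 0` for
infinitely many integers `n`"), for the Jurkat–Peyerimhoff weight at height `T₁ ≤ T`.
[cite: BorweinFergusonMossinghoff2008, §1 (7) p. 1684] [cite: HaselgroveMathematika1958, main theorem] -/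
theorem exists_neg_frequently_liouvilleHarmonicSum_lt_of_turanKernelSum_neg {T T₁ : ℝ} (hT₁ : 0 < T₁)
    (hT₁T : T₁ ≤ T)
    (hz : ∀ ρ : ℂ, riemannZeta ρ = 0 → 0 < ρ.re → ρ.re < 1 → |ρ.im| < T →
      ρ.re = 1 / 2 ∧ deriv riemannZeta ρ ≠ 0)
    {y : ℝ} (hy : (turanKernelSum (fun t : ℝ ↦ (jurkatPeyerimhoffKernel (t / T₁) : ℂ)) T y).re < 0) :
    ∃ a : ℝ, a < 0 ∧ ∃ᶠ x : ℝ in atTop, liouvilleHarmonicSum x * Real.sqrt x < a := by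
  obtain ⟨K, hK₁, hK₂, hK₃, hK₄, hK₅, hK₆, hk⟩ := exists_admissible_kernel_jurkatPeyerimhoff hT₁
  set c : ℝ := (turanKernelSum (fun t : ℝ ↦ (jurkatPeyerimhoffKernel (t / T₁) : ℂ)) T y).re with hc
  refine ⟨c / 2, by linarith, ?_⟩
  have := (turan_kernelTheorem K T hK₁ hK₂ hK₃ hK₄ (fun t ht ↦ hK₅ t (hT₁T.trans ht)) hK₆ hz y).2
    (c / 2)
  rw [hk] at this
  exact this (by linarith)

/-- **`B*(y) < 0` at one point ⟹ `T(n) < 0` for infinitely many integers `n`** (BFM 2008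
p. 1684). [cite: BorweinFergusonMossinghoff2008, §1 (7) p. 1684] [cite: HaselgroveMathematika1958, main theorem] -/
theorem frequently_liouvilleHarmonicSum_natCast_neg_of_turanKernelSum_neg {T T₁ : ℝ} (hT₁ : 0 < T₁)
    (hT₁T : T₁ ≤ T)
    (hz : ∀ ρ : ℂ, riemannZeta ρ = 0 → 0 < ρ.re → ρ.re < 1 → |ρ.im| < T →
      ρ.re = 1 / 2 ∧ deriv riemannZeta ρ ≠ 0)
    {y : ℝ} (hy : (turanKernelSum (fun t : ℝ ↦ (jurkatPeyerimhoffKernel (t / T₁) : ℂ)) T y).re < 0) :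
    ∃ᶠ n : ℕ in atTop, liouvilleHarmonicSum n < 0 := by
  obtain ⟨a, ha, hfr⟩ :=
    exists_neg_frequently_liouvilleHarmonicSum_lt_of_turanKernelSum_neg hT₁ hT₁T hz hy
  have h' : ∃ᶠ x : ℝ in atTop, liouvilleHarmonicSum x < 0 := by
    refine (hfr.and_eventually (eventually_gt_atTop 0)).mono fun x ⟨hx, hx0⟩ ↦ ?_
    have hlt : liouvilleHarmonicSum x * Real.sqrt x < 0 := hx.trans ha
    by_contra hcon
    exact absurd hlt (not_lt.2 (mul_nonneg (not_lt.1 hcon) (Real.sqrt_nonneg x)))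
  exact frequently_natCast_of_frequently_step (p := fun x ↦ liouvilleHarmonicSum x < 0)
    (fun x ↦ by rw [← TuranLiouville.liouvilleHarmonicSum_eq_floor]) h'

end Literature.NumberTheory.LFunctions
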